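import Summits.Ventures.AbcSig.Levels.N4418P1
import Summits.Ventures.AbcSig.Levels.N4418P2
import Summits.Ventures.AbcSig.Levels.N4418P3

/-!
# Venture AbcSig — GENERATED level file, level 4418 (AGGREGATOR of 3 part files)

HONEST FRAMING. As in the part files `N4418<part>.lean`, parts P1, P2, P3 (a MIXED split: parts of
different size-splits of the same generator output landed in the tree at different times; every part carries the orbit
blocks of one contiguous run of orbits of the same certified level file `N4418.engine1.json`,
sha256 `3e553c8d8a9a4e5ac1ce8d3b79aaa090140000456f1953cf331d1468a011cb4b`): this file only concatenates the orbit lists and the part summaries into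
`level4418Orbits`, `level4418_wellformed`, `level4418_sieve` (the shapes the row templates consume). The split exists because the
tree's files are ≤ 400 lines and ≤ 200 000 bytes. Union of residual exponents ≥ 7: [7, 23, 47]; orbits not eliminable by
the sieve: orbit_4418_2. No Diophantine statement is made here; no claim on ABC or any summit.
-/

namespace Summit.Ventures.AbcSig

/-- All newform orbits of level 4418 (concatenation of the parts, engine order). -/
def level4418Orbits : List OrbitData :=
  level4418OrbitsP1 ++ level4418OrbitsP2 ++ level4418OrbitsP3

/-- Every listed entry is at an odd prime not dividing 4418. -/
theorem level4418_wellformed :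
    ∀ o ∈ level4418Orbits, ∀ e ∈ o.coeffs, e.ell.Prime ∧ e.ell ≠ 2 ∧ ¬ e.ell ∣ 4418 := by
  unfold level4418Orbits
  exact List.forall_mem_append.2 ⟨List.forall_mem_append.2 ⟨level4418_wellformedP1, level4418_wellformedP2⟩, level4418_wellformedP3⟩

/-- **Level 4418 summary.** For a prime exponent `n ≥ 7`, every orbit of level 4418 is sieve-eliminated by the
kernel certificates of the part files, except that the row's predicate `X` is assumed for: orbit_4418_2, orbit_4418_1 if n ∈ [7], orbit_4418_3 if n ∈ [7], orbit_4418_5 if n ∈ [7], orbit_4418_6 if n ∈ [7], orbit_4418_9 if n ∈ [7], orbit_4418_19 if n ∈ [47], orbit_4418_20 if n ∈ [47], orbit_4418_21 if n ∈ [23, 47], orbit_4418_22 if n ∈ [23, 47], orbit_4418_23 if n ∈ [47]. -/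
theorem level4418_sieve (n : ℕ) (hn : n.Prime) (hmin : 7 ≤ n) (X : OrbitData → Prop)
    (h_orbit_4418_1 : n ∈ ([7] : List ℕ) → X orbit_4418_1)
    (h_orbit_4418_2 : X orbit_4418_2)
    (h_orbit_4418_3 : n ∈ ([7] : List ℕ) → X orbit_4418_3)
    (h_orbit_4418_5 : n ∈ ([7] : List ℕ) → X orbit_4418_5)
    (h_orbit_4418_6 : n ∈ ([7] : List ℕ) → X orbit_4418_6)
    (h_orbit_4418_9 : n ∈ ([7] : List ℕ) → X orbit_4418_9)
    (h_orbit_4418_19 : n ∈ ([47] : List ℕ) → X orbit_4418_19)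
    (h_orbit_4418_20 : n ∈ ([47] : List ℕ) → X orbit_4418_20)
    (h_orbit_4418_21 : n ∈ ([23, 47] : List ℕ) → X orbit_4418_21)
    (h_orbit_4418_22 : n ∈ ([23, 47] : List ℕ) → X orbit_4418_22)
    (h_orbit_4418_23 : n ∈ ([47] : List ℕ) → X orbit_4418_23) :
    ∀ o ∈ level4418Orbits, (∀ e ∈ o.coeffs, e.ell.Prime ∧ e.ell ≠ 2 ∧ ¬ e.ell ∣ 4418) ∧ (o.Eliminated bs04Allowed n ∨ X o) := by
  unfold level4418Orbits
  exact List.forall_mem_append.2 ⟨List.forall_mem_append.2 ⟨(level4418_sieveP1 n hn hmin X h_orbit_4418_1 h_orbit_4418_2 h_orbit_4418_3 h_orbit_4418_5 h_orbit_4418_6 h_orbit_4418_9 h_orbit_4418_19 h_orbit_4418_20), (level4418_sieveP2 n hn hmin X h_orbit_4418_21)⟩, (level4418_sieveP3 n hn hmin X h_orbit_4418_22 h_orbit_4418_23)⟩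

end Summit.Ventures.AbcSig
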